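import Summits.BirchSwinnertonDyer.BirchSwinnertonDyer.Theorems.UniversalToricDescentThinCombInvolutiveReflection
import Literature.NumberTheory.EllipticCurves.IwasawaAlgebraTwoVarGeneratorChange
import Summits.BirchSwinnertonDyer.Rank1Residual.X2.HidaLimitCongruenceAlgebra
import Summits.BirchSwinnertonDyer.Rank1Residual.X11b.HalvesReceptacle
import HarnessLib

/-!
# Thin-comb rigidity for GROUP-LIKE reflections `φ_A`, `A ∈ GL₂(ℤ_p)` (helper on the rational wall
# `RationalSplitIMCInclusionAtThree`, item stmt-BirchSwinnertonDyer-24207, line `ratwall_thin_comb`; cell `pub/bsd-wall`,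
# LEAD `cruxlead-24207` g5; `--supports stmt-BirchSwinnertonDyer-24207`)

WHY THIS FILE. The functional-equation stub `stub_reflectionSymmetryUpTo2` of the line (v5) asks for SOME ring automorphism
`ρ` of `Λ₂(𝒪) = 𝒪⟦T₂⟧⟦T₁⟧` (`𝒪 = R₀ = unrIntegers 3`) which (i) fixes constants, (ii) does not stabilise the comb's bad
ideal, `ρ T₂ ∉ (p, T₂)`, and makes (iii) the characteristic element `G` and (iv) the toric two-variable function `L₂`
symmetric up to units. The INTENDED `ρ` is not an arbitrary automorphism: it is the substitution of `𝒪⟦Gal(K̃_∞/K)⟧`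
induced by Büyükboduk–Lei's involution `τ : γ ↦ c γ⁻¹ c⁻¹` of `Γ = Gal(K̃_∞/K) ≅ ℤ_p²`, i.e. — in a generator pair
`(γ₁, γ₂)`, `γ_i ↔ 1 + T_i` — the GROUP-LIKE frame substitution `φ_A = IwasawaAlgebra₂.frameSubst 𝒪 A`
(`Literature/NumberTheory/EllipticCurves/IwasawaAlgebraTwoVarGeneratorChange.lean`: `1 + T₁ ↦ (1+T₁)^a (1+T₂)^c`,
`1 + T₂ ↦ (1+T₁)^b (1+T₂)^d`) of the matrix `A = A_τ ∈ GL₂(ℤ_p)` of `τ`, which is an INVOLUTION (`A · A = 1`). For such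
`ρ` clauses (i) and (ii) are KERNEL FACTS, not stub obligations: (i) is `frameSubst_C_C`, and (ii) holds iff the
off-diagonal entry `b = A 0 1` is non-zero (`frameSubst_C_X_not_mem_span_iff`, Lucas) — for `A_τ` this is the frame
geometry «`c γ₂ c` spans the `𝔭`-inertia line `≠` the `𝔭′`-line»; and by the involutive-reflection lemma of the line
(`InvolutiveReflection.associated_map_iff_dvd_map`, p741475) the two `Associated` clauses are the ONE-SIDED
divisibilities `G ∣ φ_A G`, `L₂ ∣ φ_A L₂` that the algebraic (Hao–Lim 2026) and analytic (Hao–Loeffler 2025 Thm. 4.9)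
functional equations deliver before any unit bookkeeping. This file records the rigidity step of the line (Part VII,
`dvd_pow_mul_of_weakReflection`) in that GROUP-LIKE CURRENCY, and the comparison map from the group-like form of the
stub to its registered v5 form (`exists_weakReflection_of_groupLike`), so that the line may quantify its symmetry stub
over the four `p`-adic parameters of `A` instead of over `Aut Λ₂(𝒪)` (skeleton v6 of `Lines/ratwall_thin_comb.lean`).

CONTENTS (theorems only; no definition, no instance, no notation, no `sorry`; nothing about elliptic curves):
* §1 `frameSubst_const`, `frameSubst_T₂_not_mem_iff`, `frameSubst_T₂_not_mem`, `frameSubst_frameSubst_of_mul_self` — the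
  weak-reflection clauses of the route (`const`, `T₂` of `UniversalToricDescentThinCombDefs`) for `φ_A`, any `ℤ_p`-algebra `𝒪`.
* §2 `associated_frameSubst_iff_dvd`, `dvd_pow_mul_of_groupLikeReflection`, `dvd_of_groupLikeReflection`,
  `exists_weakReflection_of_groupLike` — every DVR `𝒪` with maximal ideal `(p)` that is a `ℤ_p`-algebra.
* §3 `dvd_pow_mul_of_groupLikeReflection_unr`, `exists_weakReflection_of_groupLike_unr` — the receptacle
  `R₀ = unrIntegers p` of the wall with its structure map `toUnr p : ℤ_p → R₀`.
* §4 `reflectionFrame_mul_self`, `reflectionFrame_apply_zero_one`, `exists_involutive_offDiagonal_ne_zero` — the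
  side conditions `A · A = 1`, `A 0 1 ≠ 0` are satisfiable (`A = (0 −1; −1 0)`, the route's `IsReflection` shape); says
  nothing about any particular `G`, `L₂`.

HONEST FRAMING. Algebra only: neither functional equation is proved here, `A_τ` is not constructed here (the Galois
dictionary `IwasawaAlgebra₂.frameMatrixOf` names its entries), and nothing is claimed about the existence of the toric
two-variable function or of the comb divisibility; BSD is not proved by any of this; 24207 stays OPEN.
References: Neukirch–Schmidt–Wingberg (5.3.5) [cite: NeukirchSchmidtWingberg2008, (5.3.5)]; Washington §7.1–7.2, §13.4
[cite: Washington1997, §7.1–§7.2 and §13.4]; Büyükboduk–Lei, arXiv:1707.00557, Def. 3.8 (the involution `τ`)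
[cite: BuyukbodukLei2017, Def. 3.8]; Matsumura Thm. 20.3 [cite: Matsumura1987, Thm. 20.3].
-/

set_option linter.dupNamespace false
set_option autoImplicit false

noncomputable section

open scoped MatrixGroups
open Literature.NumberTheory.EllipticCurves

namespace Summit.BirchSwinnertonDyer.BirchSwinnertonDyer.Theorems.UniversalToricDescentThinComb.GroupLikeReflection

/-! ## §1 The weak-reflection clauses for a group-like substitution `φ_A` -/

section Frame

variable (𝒪 : Type*) [CommRing 𝒪] {p : ℕ} [Fact p.Prime] [Algebra ℤ_[p] 𝒪] (A : GL (Fin 2) ℤ_[p])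

/-- **(i) `φ_A` fixes constants**: `frameSubst A (const r) = const r` (the route's `const 𝒪 = C ∘ C`).
[cite: NeukirchSchmidtWingberg2008, (5.3.5)] -/
theorem frameSubst_const (r : 𝒪) : IwasawaAlgebra₂.frameSubst 𝒪 A (const 𝒪 r) = const 𝒪 r :=
  IwasawaAlgebra₂.frameSubst_C_C 𝒪 A r

/-- **(ii) THE WEAK-REFLECTION CRITERION in the route's vocabulary**: if `p` is not a unit of `𝒪`, then
`φ_A (T₂) ∉ (const p, T₂)` iff the off-diagonal entry `b = A 0 1` is non-zero (`φ_A (T₂) = (1+T₁)^b (1+T₂)^d − 1`;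
`b = u·p^e ≠ 0` contributes the coefficient `(b choose p^e) ≡ u (mod p)` of `T₁^{p^e}`, Lucas).
[cite: NeukirchSchmidtWingberg2008, (5.3.5)] [cite: Washington1997, §7.1] -/
theorem frameSubst_T₂_not_mem_iff (hp : ¬ IsUnit (p : 𝒪)) :
    IwasawaAlgebra₂.frameSubst 𝒪 A (T₂ 𝒪) ∉ Ideal.span {const 𝒪 (p : 𝒪), T₂ 𝒪} ↔
      (A : Matrix (Fin 2) (Fin 2) ℤ_[p]) 0 1 ≠ 0 :=
  IwasawaAlgebra₂.frameSubst_C_X_not_mem_span_iff 𝒪 hp A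

/-- **(ii)** for `b ≠ 0`: `φ_A (T₂) ∉ (const p, T₂)`. [cite: NeukirchSchmidtWingberg2008, (5.3.5)] [cite: Washington1997, §7.1] -/
theorem frameSubst_T₂_not_mem (hp : ¬ IsUnit (p : 𝒪)) (hb : (A : Matrix (Fin 2) (Fin 2) ℤ_[p]) 0 1 ≠ 0) :
    IwasawaAlgebra₂.frameSubst 𝒪 A (T₂ 𝒪) ∉ Ideal.span {const 𝒪 (p : 𝒪), T₂ 𝒪} :=
  (frameSubst_T₂_not_mem_iff 𝒪 A hp).mpr hb

/-- **An involutive matrix gives an involutive substitution**: `A · A = 1 ⟹ φ_A (φ_A F) = F` (composition law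
`φ_{AB} = φ_A ∘ φ_B` and `φ_1 = id`). [cite: NeukirchSchmidtWingberg2008, (5.3.5)] -/
theorem frameSubst_frameSubst_of_mul_self (hA : A * A = 1) (F : PowerSeries (PowerSeries 𝒪)) :
    IwasawaAlgebra₂.frameSubst 𝒪 A (IwasawaAlgebra₂.frameSubst 𝒪 A F) = F := by
  rw [← IwasawaAlgebra₂.frameSubst_mul, hA, IwasawaAlgebra₂.frameSubst_one]
  rfl

end Frame

/-! ## §2 Rigidity in group-like currency (every DVR `𝒪` with maximal ideal `(p)` that is a `ℤ_p`-algebra) -/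

section Rigidity

variable (𝒪 : Type*) [CommRing 𝒪] [IsDomain 𝒪] [IsDiscreteValuationRing 𝒪] (p : ℕ) [hp : Fact p.Prime]
  [Algebra ℤ_[p] 𝒪]

omit [IsDiscreteValuationRing 𝒪] in
/-- For an involutive `A`, symmetry of `F` up to a unit under `φ_A` is the one-sided divisibility `F ∣ φ_A F`
(`InvolutiveReflection.associated_map_iff_dvd_map` for `ρ = φ_A`). [cite: Washington1997, §13.4] -/
theorem associated_frameSubst_iff_dvd (A : GL (Fin 2) ℤ_[p]) (hA : A * A = 1) (F : PowerSeries (PowerSeries 𝒪)) :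
    Associated (IwasawaAlgebra₂.frameSubst 𝒪 A F) F ↔ F ∣ IwasawaAlgebra₂.frameSubst 𝒪 A F :=
  InvolutiveReflection.associated_map_iff_dvd_map (IwasawaAlgebra₂.frameSubst 𝒪 A)
    (frameSubst_frameSubst_of_mul_self 𝒪 A hA) F

/-- **RIGIDITY FOR GROUP-LIKE INVOLUTIVE REFLECTIONS, rational form.** For every DVR `𝒪` with maximal ideal `(p)`
that is a `ℤ_p`-algebra, every `A ∈ GL₂(ℤ_p)` with `A · A = 1` and `A 0 1 ≠ 0`: if `G ∣ φ_A G`, `F ∣ φ_A F` (one-sided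
algebraic and analytic functional equations) and `G ∣ p^{t_m}·F (mod E_m(T₂))` on comb levels of unbounded order
(`ThinCombDvdRat`), then `G ∣ p^a·F` for some `a`. (Part VII `dvd_pow_mul_of_weakReflection` via
`InvolutiveReflection.dvd_pow_mul_of_involutiveWeakReflection`; clauses (i), (ii) from §1.)
[cite: Washington1997, §7.1–§7.2 and §13.4] [cite: Matsumura1987, Thm. 20.3] -/
theorem dvd_pow_mul_of_groupLikeReflection (hmax : IsLocalRing.maximalIdeal 𝒪 = Ideal.span {(p : 𝒪)})
    (A : GL (Fin 2) ℤ_[p]) (hA : A * A = 1) (hb : (A : Matrix (Fin 2) (Fin 2) ℤ_[p]) 0 1 ≠ 0)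
    (G F : PowerSeries (PowerSeries 𝒪)) (hG : G ∣ IwasawaAlgebra₂.frameSubst 𝒪 A G)
    (hF : F ∣ IwasawaAlgebra₂.frameSubst 𝒪 A F) (hcomb : ThinCombDvdRat 𝒪 p G F) :
    ∃ a : ℕ, G ∣ const 𝒪 ((p : 𝒪) ^ a) * F :=
  InvolutiveReflection.dvd_pow_mul_of_involutiveWeakReflection 𝒪 p hmax (IwasawaAlgebra₂.frameSubst 𝒪 A)
    (frameSubst_frameSubst_of_mul_self 𝒪 A hA) (frameSubst_const 𝒪 A)
    (frameSubst_T₂_not_mem 𝒪 A (p_ne_zero_of_maximalIdeal_eq 𝒪 p hmax).2.1 hb) G F hG hF hcomb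

/-- **RIGIDITY FOR GROUP-LIKE INVOLUTIVE REFLECTIONS, integral form**: with integral comb divisibility
(`ThinCombDvdInt`), `G ∣ F`. [cite: Washington1997, §7.1–§7.2 and §13.4] [cite: Matsumura1987, Thm. 20.3] -/
theorem dvd_of_groupLikeReflection (hmax : IsLocalRing.maximalIdeal 𝒪 = Ideal.span {(p : 𝒪)})
    (A : GL (Fin 2) ℤ_[p]) (hA : A * A = 1) (hb : (A : Matrix (Fin 2) (Fin 2) ℤ_[p]) 0 1 ≠ 0)
    (G F : PowerSeries (PowerSeries 𝒪)) (hG : G ∣ IwasawaAlgebra₂.frameSubst 𝒪 A G)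
    (hF : F ∣ IwasawaAlgebra₂.frameSubst 𝒪 A F) (hcombI : ThinCombDvdInt 𝒪 p G F) : G ∣ F :=
  InvolutiveReflection.dvd_of_involutiveWeakReflection 𝒪 p hmax (IwasawaAlgebra₂.frameSubst 𝒪 A)
    (frameSubst_frameSubst_of_mul_self 𝒪 A hA) (frameSubst_const 𝒪 A)
    (frameSubst_T₂_not_mem 𝒪 A (p_ne_zero_of_maximalIdeal_eq 𝒪 p hmax).2.1 hb) G F hG hF hcombI

omit [IsDiscreteValuationRing 𝒪] in
/-- **The group-like form of the symmetry stub implies its registered (v5) form.** If some involutive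
`A ∈ GL₂(ℤ_p)` with `A 0 1 ≠ 0` has `G ∣ φ_A G` and `F ∣ φ_A F`, then there is a weak reflection `ρ` (fixing constants,
`ρ T₂ ∉ (p, T₂)`) with `ρ G ∼ G` and `ρ F ∼ F` — namely `ρ = φ_A`. (So quantifying the line's stub over `A` instead of over
`Aut Λ₂(𝒪)` is a STRENGTHENING whose extra content is exactly the group-likeness of the intended `ρ`.)
[cite: NeukirchSchmidtWingberg2008, (5.3.5)] [cite: Washington1997, §13.4] -/
theorem exists_weakReflection_of_groupLike (hpu : ¬ IsUnit (p : 𝒪)) {G F : PowerSeries (PowerSeries 𝒪)}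
    (h : ∃ A : GL (Fin 2) ℤ_[p], A * A = 1 ∧ (A : Matrix (Fin 2) (Fin 2) ℤ_[p]) 0 1 ≠ 0 ∧
      G ∣ IwasawaAlgebra₂.frameSubst 𝒪 A G ∧ F ∣ IwasawaAlgebra₂.frameSubst 𝒪 A F) :
    ∃ ρ : PowerSeries (PowerSeries 𝒪) ≃+* PowerSeries (PowerSeries 𝒪),
      (∀ c : 𝒪, ρ (const 𝒪 c) = const 𝒪 c) ∧ ρ (T₂ 𝒪) ∉ Ideal.span {const 𝒪 (p : 𝒪), T₂ 𝒪} ∧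
      Associated (ρ G) G ∧ Associated (ρ F) F := by
  obtain ⟨A, hA, hb, hG, hF⟩ := h
  exact ⟨IwasawaAlgebra₂.frameSubst 𝒪 A, frameSubst_const 𝒪 A, frameSubst_T₂_not_mem 𝒪 A hpu hb,
    (associated_frameSubst_iff_dvd 𝒪 p A hA G).mpr hG, (associated_frameSubst_iff_dvd 𝒪 p A hA F).mpr hF⟩

end Rigidity

/-! ## §3 The receptacle `R₀ = unrIntegers p` of the wall (structure map `toUnr p : ℤ_p → R₀`) -/

section Unr

open Summit.BirchSwinnertonDyer.Rank1Residual.X11b.Halves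

variable (p : ℕ) [hp : Fact p.Prime]

/-- The maximal ideal of the DVR `R₀ = unrIntegers p` is `(p)` (tree: `HidaLimitAlgebra`). [cite: Washington1997, §7.1] -/
theorem maximalIdeal_unrIntegers_eq :
    letI := Summit.BirchSwinnertonDyer.Rank1Residual.X2.HidaLimitAlgebra.isDiscreteValuationRing_unrIntegers (p := p)
    IsLocalRing.maximalIdeal (unrIntegers p) = Ideal.span {((p : ℕ) : unrIntegers p)} := by
  letI := Summit.BirchSwinnertonDyer.Rank1Residual.X2.HidaLimitAlgebra.isDiscreteValuationRing_unrIntegers (p := p)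
  exact (IsDiscreteValuationRing.irreducible_iff_uniformizer _).mp
    Summit.BirchSwinnertonDyer.Rank1Residual.X2.HidaLimitAlgebra.irreducible_natCast_p

/-- **RIGIDITY FOR GROUP-LIKE INVOLUTIVE REFLECTIONS over `R₀ = unrIntegers p`** (the line's receptacle
`R₀⟦T₂⟧⟦T₁⟧`, `ℤ_p`-algebra through `toUnr p`): `A · A = 1`, `A 0 1 ≠ 0`, `G ∣ φ_A G`, `F ∣ φ_A F`, rational comb
divisibility `⟹ G ∣ p^a F`. [cite: Washington1997, §7.1–§7.2 and §13.4] [cite: Matsumura1987, Thm. 20.3] -/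
theorem dvd_pow_mul_of_groupLikeReflection_unr (A : GL (Fin 2) ℤ_[p]) (hA : A * A = 1)
    (hb : (A : Matrix (Fin 2) (Fin 2) ℤ_[p]) 0 1 ≠ 0) (G F : PowerSeries (UnrSeries p)) :
    letI : Algebra ℤ_[p] (unrIntegers p) := (toUnr p).toAlgebra
    G ∣ IwasawaAlgebra₂.frameSubst (unrIntegers p) A G → F ∣ IwasawaAlgebra₂.frameSubst (unrIntegers p) A F →
      ThinCombDvdRat (unrIntegers p) p G F →
      ∃ a : ℕ, G ∣ const (unrIntegers p) (((p : ℕ) : unrIntegers p) ^ a) * F := by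
  letI : Algebra ℤ_[p] (unrIntegers p) := (toUnr p).toAlgebra
  intro hG hF hcomb
  letI := Summit.BirchSwinnertonDyer.Rank1Residual.X2.HidaLimitAlgebra.isDiscreteValuationRing_unrIntegers (p := p)
  exact dvd_pow_mul_of_groupLikeReflection (unrIntegers p) p (maximalIdeal_unrIntegers_eq p) A hA hb G F hG hF hcomb

/-- **Group-like form ⟹ registered form, over `R₀`**: an involutive `A` with `A 0 1 ≠ 0`, `G ∣ φ_A G`, `F ∣ φ_A F`
yields a weak reflection `ρ = φ_A` of `R₀⟦T₂⟧⟦T₁⟧` fixing constants with `ρ T₂ ∉ (p, T₂)`, `ρ G ∼ G`, `ρ F ∼ F` — the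
conclusion of the line's v5 stub `stub_reflectionSymmetryUpTo2` for this `G`, `F`.
[cite: NeukirchSchmidtWingberg2008, (5.3.5)] [cite: Washington1997, §13.4] -/
theorem exists_weakReflection_of_groupLike_unr {G F : PowerSeries (UnrSeries p)} :
    letI : Algebra ℤ_[p] (unrIntegers p) := (toUnr p).toAlgebra
    (∃ A : GL (Fin 2) ℤ_[p], A * A = 1 ∧ (A : Matrix (Fin 2) (Fin 2) ℤ_[p]) 0 1 ≠ 0 ∧
      G ∣ IwasawaAlgebra₂.frameSubst (unrIntegers p) A G ∧ F ∣ IwasawaAlgebra₂.frameSubst (unrIntegers p) A F) →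
    ∃ ρ : PowerSeries (UnrSeries p) ≃+* PowerSeries (UnrSeries p),
      (∀ c : unrIntegers p, ρ (const (unrIntegers p) c) = const (unrIntegers p) c) ∧
      ρ (T₂ (unrIntegers p)) ∉ Ideal.span {const (unrIntegers p) ((p : ℕ) : unrIntegers p), T₂ (unrIntegers p)} ∧
      Associated (ρ G) G ∧ Associated (ρ F) F := by
  letI : Algebra ℤ_[p] (unrIntegers p) := (toUnr p).toAlgebra
  intro h
  exact exists_weakReflection_of_groupLike (unrIntegers p) p
    Summit.BirchSwinnertonDyer.Rank1Residual.X2.HidaLimitAlgebra.irreducible_natCast_p.not_isUnit h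

end Unr

/-! ## §4 The side conditions are satisfiable: the reflection frame `(0 −1; −1 0)` -/

section Example

variable (p : ℕ) [hp : Fact p.Prime]

/-- The reflection frame `(0 −1; −1 0)` (`γ₁ ↦ γ₂⁻¹`, `γ₂ ↦ γ₁⁻¹`) is an involution of `GL₂(ℤ_p)`.
[cite: NeukirchSchmidtWingberg2008, (5.3.5)] -/
theorem reflectionFrame_mul_self :
    (IwasawaAlgebra₂.reflectionFrame (p := p)) * IwasawaAlgebra₂.reflectionFrame = 1 := by
  apply Units.ext
  rw [Units.val_mul, IwasawaAlgebra₂.val_reflectionFrame, Units.val_one]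
  ext i j
  fin_cases i <;> fin_cases j <;> simp [Matrix.mul_apply, Fin.sum_univ_two]

/-- Its off-diagonal entry is `b = −1`. [cite: NeukirchSchmidtWingberg2008, (5.3.5)] -/
theorem reflectionFrame_apply_zero_one :
    ((IwasawaAlgebra₂.reflectionFrame (p := p) : GL (Fin 2) ℤ_[p]) : Matrix (Fin 2) (Fin 2) ℤ_[p]) 0 1 = -1 := by
  rw [IwasawaAlgebra₂.val_reflectionFrame]
  rfl

/-- **The witness space of the group-like symmetry stub's side conditions is non-empty**: there is an involutive
`A ∈ GL₂(ℤ_p)` with `A 0 1 ≠ 0` (the reflection frame; `−1 ≠ 0` in `ℤ_p`). This says nothing about any particular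
`G` or `L₂`. [cite: NeukirchSchmidtWingberg2008, (5.3.5)] -/
theorem exists_involutive_offDiagonal_ne_zero :
    ∃ A : GL (Fin 2) ℤ_[p], A * A = 1 ∧ (A : Matrix (Fin 2) (Fin 2) ℤ_[p]) 0 1 ≠ 0 :=
  ⟨IwasawaAlgebra₂.reflectionFrame, reflectionFrame_mul_self p,
    by rw [reflectionFrame_apply_zero_one]; exact neg_ne_zero.mpr one_ne_zero⟩

end Example

/-! ## §5 The symmetry stub in its WEAKEST group-like form: `Associated` under some `φ_A` with `A 0 1 ≠ 0`
(appended 2026-08-29, LEAD `cruxlead-24207` g5, for skeleton v6 of `Lines/ratwall_thin_comb.lean`) -/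

section Weakest

variable (𝒪 : Type*) [CommRing 𝒪] [IsDomain 𝒪] [IsDiscreteValuationRing 𝒪] (p : ℕ) [hp : Fact p.Prime]
  [Algebra ℤ_[p] 𝒪]

/-- **RIGIDITY FOR GROUP-LIKE WEAK REFLECTIONS, rational form, `Associated` hypotheses** (no involution assumed):
for every DVR `𝒪` with maximal ideal `(p)` that is a `ℤ_p`-algebra and every `A ∈ GL₂(ℤ_p)` with `A 0 1 ≠ 0`, if
`φ_A G ∼ G`, `φ_A F ∼ F` and `G ∣ p^{t_m}·F (mod E_m(T₂))` on comb levels of unbounded order, then `G ∣ p^a·F` for some `a`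
— Part VII `dvd_pow_mul_of_weakReflection` for `ρ = φ_A`, whose two side conditions are the kernel facts of §1. This is the
form in which the line's v6 stub `stub_groupLikeSymmetryUpTo2` is consumed.
[cite: Washington1997, §7.1–§7.2 and §13.4] [cite: Matsumura1987, Thm. 20.3] -/
theorem dvd_pow_mul_of_frameSubst (hmax : IsLocalRing.maximalIdeal 𝒪 = Ideal.span {(p : 𝒪)})
    (A : GL (Fin 2) ℤ_[p]) (hb : (A : Matrix (Fin 2) (Fin 2) ℤ_[p]) 0 1 ≠ 0) (G F : PowerSeries (PowerSeries 𝒪))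
    (hG : Associated (IwasawaAlgebra₂.frameSubst 𝒪 A G) G) (hF : Associated (IwasawaAlgebra₂.frameSubst 𝒪 A F) F)
    (hcomb : ThinCombDvdRat 𝒪 p G F) : ∃ a : ℕ, G ∣ const 𝒪 ((p : 𝒪) ^ a) * F :=
  dvd_pow_mul_of_weakReflection 𝒪 p hmax (IwasawaAlgebra₂.frameSubst 𝒪 A) (frameSubst_const 𝒪 A)
    (frameSubst_T₂_not_mem 𝒪 A (p_ne_zero_of_maximalIdeal_eq 𝒪 p hmax).2.1 hb) G F hG hF hcomb

/-- **Integral form** of `dvd_pow_mul_of_frameSubst`: with `ThinCombDvdInt`, `G ∣ F`.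
[cite: Washington1997, §7.1–§7.2 and §13.4] [cite: Matsumura1987, Thm. 20.3] -/
theorem dvd_of_frameSubst (hmax : IsLocalRing.maximalIdeal 𝒪 = Ideal.span {(p : 𝒪)})
    (A : GL (Fin 2) ℤ_[p]) (hb : (A : Matrix (Fin 2) (Fin 2) ℤ_[p]) 0 1 ≠ 0) (G F : PowerSeries (PowerSeries 𝒪))
    (hG : Associated (IwasawaAlgebra₂.frameSubst 𝒪 A G) G) (hF : Associated (IwasawaAlgebra₂.frameSubst 𝒪 A F) F)
    (hcombI : ThinCombDvdInt 𝒪 p G F) : G ∣ F :=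
  dvd_of_weakReflection 𝒪 p hmax (IwasawaAlgebra₂.frameSubst 𝒪 A) (frameSubst_const 𝒪 A)
    (frameSubst_T₂_not_mem 𝒪 A (p_ne_zero_of_maximalIdeal_eq 𝒪 p hmax).2.1 hb) G F hG hF hcombI

omit [IsDiscreteValuationRing 𝒪] [IsDomain 𝒪] in
/-- **Group-like `Associated` form ⟹ registered v5 form** (`ρ = φ_A`): from `A 0 1 ≠ 0`, `φ_A G ∼ G`, `φ_A F ∼ F` to a weak
reflection fixing constants with `ρ T₂ ∉ (p, T₂)`, `ρ G ∼ G`, `ρ F ∼ F`. [cite: NeukirchSchmidtWingberg2008, (5.3.5)] [cite: Washington1997, §13.4] -/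
theorem exists_weakReflection_of_frameSubst (hpu : ¬ IsUnit (p : 𝒪)) {G F : PowerSeries (PowerSeries 𝒪)}
    (h : ∃ A : GL (Fin 2) ℤ_[p], (A : Matrix (Fin 2) (Fin 2) ℤ_[p]) 0 1 ≠ 0 ∧
      Associated (IwasawaAlgebra₂.frameSubst 𝒪 A G) G ∧ Associated (IwasawaAlgebra₂.frameSubst 𝒪 A F) F) :
    ∃ ρ : PowerSeries (PowerSeries 𝒪) ≃+* PowerSeries (PowerSeries 𝒪),
      (∀ c : 𝒪, ρ (const 𝒪 c) = const 𝒪 c) ∧ ρ (T₂ 𝒪) ∉ Ideal.span {const 𝒪 (p : 𝒪), T₂ 𝒪} ∧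
      Associated (ρ G) G ∧ Associated (ρ F) F := by
  obtain ⟨A, hb, hG, hF⟩ := h
  exact ⟨IwasawaAlgebra₂.frameSubst 𝒪 A, frameSubst_const 𝒪 A, frameSubst_T₂_not_mem 𝒪 A hpu hb, hG, hF⟩

omit [IsDiscreteValuationRing 𝒪] in
/-- **Involutive one-sided form ⟹ `Associated` form** (for closers holding `A · A = 1` and the functional equations as
one-sided divisibilities): `A·A = 1`, `A 0 1 ≠ 0`, `G ∣ φ_A G`, `F ∣ φ_A F` give the v6 stub's conclusion for `G`, `F`.
[cite: Washington1997, §13.4] -/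
theorem exists_frameSubst_associated_of_involutive {G F : PowerSeries (PowerSeries 𝒪)}
    (h : ∃ A : GL (Fin 2) ℤ_[p], A * A = 1 ∧ (A : Matrix (Fin 2) (Fin 2) ℤ_[p]) 0 1 ≠ 0 ∧
      G ∣ IwasawaAlgebra₂.frameSubst 𝒪 A G ∧ F ∣ IwasawaAlgebra₂.frameSubst 𝒪 A F) :
    ∃ A : GL (Fin 2) ℤ_[p], (A : Matrix (Fin 2) (Fin 2) ℤ_[p]) 0 1 ≠ 0 ∧
      Associated (IwasawaAlgebra₂.frameSubst 𝒪 A G) G ∧ Associated (IwasawaAlgebra₂.frameSubst 𝒪 A F) F := by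
  obtain ⟨A, hA, hb, hG, hF⟩ := h
  exact ⟨A, hb, (associated_frameSubst_iff_dvd 𝒪 p A hA G).mpr hG, (associated_frameSubst_iff_dvd 𝒪 p A hA F).mpr hF⟩

end Weakest

section WeakestUnr

open Summit.BirchSwinnertonDyer.Rank1Residual.X11b.Halves

variable (p : ℕ) [hp : Fact p.Prime]

/-- **Rigidity over `R₀ = unrIntegers p`, `Associated` hypotheses** (the form consumed by `_of` of skeleton v6): `A 0 1 ≠ 0`,
`φ_A G ∼ G`, `φ_A F ∼ F`, rational comb divisibility `⟹ G ∣ p^a F`.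
[cite: Washington1997, §7.1–§7.2 and §13.4] [cite: Matsumura1987, Thm. 20.3] -/
theorem dvd_pow_mul_of_frameSubst_unr (A : GL (Fin 2) ℤ_[p]) (hb : (A : Matrix (Fin 2) (Fin 2) ℤ_[p]) 0 1 ≠ 0)
    (G F : PowerSeries (UnrSeries p)) :
    letI : Algebra ℤ_[p] (unrIntegers p) := (toUnr p).toAlgebra
    Associated (IwasawaAlgebra₂.frameSubst (unrIntegers p) A G) G →
      Associated (IwasawaAlgebra₂.frameSubst (unrIntegers p) A F) F → ThinCombDvdRat (unrIntegers p) p G F →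
      ∃ a : ℕ, G ∣ const (unrIntegers p) (((p : ℕ) : unrIntegers p) ^ a) * F := by
  letI : Algebra ℤ_[p] (unrIntegers p) := (toUnr p).toAlgebra
  intro hG hF hcomb
  letI := Summit.BirchSwinnertonDyer.Rank1Residual.X2.HidaLimitAlgebra.isDiscreteValuationRing_unrIntegers (p := p)
  exact dvd_pow_mul_of_frameSubst (unrIntegers p) p (maximalIdeal_unrIntegers_eq p) A hb G F hG hF hcomb

/-- **Group-like `Associated` form ⟹ registered v5 form, over `R₀`**: the v6 stub `stub_groupLikeSymmetryUpTo2` of the line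
implies v5's `stub_reflectionSymmetryUpTo2` for the same `G`, `F` (`ρ = φ_A`). [cite: NeukirchSchmidtWingberg2008, (5.3.5)] [cite: Washington1997, §13.4] -/
theorem exists_weakReflection_of_frameSubst_unr {G F : PowerSeries (UnrSeries p)} :
    letI : Algebra ℤ_[p] (unrIntegers p) := (toUnr p).toAlgebra
    (∃ A : GL (Fin 2) ℤ_[p], (A : Matrix (Fin 2) (Fin 2) ℤ_[p]) 0 1 ≠ 0 ∧
      Associated (IwasawaAlgebra₂.frameSubst (unrIntegers p) A G) G ∧
      Associated (IwasawaAlgebra₂.frameSubst (unrIntegers p) A F) F) →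
    ∃ ρ : PowerSeries (UnrSeries p) ≃+* PowerSeries (UnrSeries p),
      (∀ c : unrIntegers p, ρ (const (unrIntegers p) c) = const (unrIntegers p) c) ∧
      ρ (T₂ (unrIntegers p)) ∉ Ideal.span {const (unrIntegers p) ((p : ℕ) : unrIntegers p), T₂ (unrIntegers p)} ∧
      Associated (ρ G) G ∧ Associated (ρ F) F := by
  letI : Algebra ℤ_[p] (unrIntegers p) := (toUnr p).toAlgebra
  intro h
  exact exists_weakReflection_of_frameSubst (unrIntegers p) p
    Summit.BirchSwinnertonDyer.Rank1Residual.X2.HidaLimitAlgebra.irreducible_natCast_p.not_isUnit h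

end WeakestUnr

end Summit.BirchSwinnertonDyer.BirchSwinnertonDyer.Theorems.UniversalToricDescentThinComb.GroupLikeReflection

end
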